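import Summits.BirchSwinnertonDyer.BirchSwinnertonDyer.Theses.PrintX6
import Summits.BirchSwinnertonDyer.Rank1Residual.X4.KuriharaLowerHalf
import Literature.NumberTheory.EllipticCurves.KuriharaNumberInvariants
import Literature.NumberTheory.EllipticCurves.Kobayashi2003.SignedKatoDivisibility
import HarnessLib

/-!
# Line `log-witness` — crux `EisensteinHalfFiveLeRest` (route PrintX6, item stmt-BirchSwinnertonDyer-21116,
# rank 211): the Eisenstein (lower) half `ord_p #Ш_an ≤ ord_p #Ш` on X6 ∧ ¬CM ∧ `p ≥ 5` ∧ `r_an = 0` OFF the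
# erratum sub-locus, certified by the SECOND (logarithmic) `p`-adic coordinate of Kato's class — the
# `±`-LOG-WRONSKIAN `𝔚 = 2·L_p⁺ − (p−1)·L_p⁻` at `T = 0` — squared by the Cassels–Tate pairing (lens: dual witness).

HONEST FRAMING (D-0152 / W-71, seat bsd-idea-19, lens = dual): this line feeds the CLASS route PrintX6 (leaf
`WAllCornerX6r0`); BSD is not proved by any of this; every stub below is `sorry`; `EisensteinHalfFiveLeRest_of`
only shows — kernel-checked — that the four stub STATEMENTS give the crux BY NAME, and
`EisensteinHalfFiveLeRest_of_stubs` that the registered stubs have literally those statements.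

THE LEVER.  Write `T = T_pE`, `z ∈ H¹(ℤ[1/Np], T) ≅ ℤ_p` for Kato's class, `a := ∂^(∞)(κ^{Kato})` for the
`p`-divisibility of Kato's KOLYVAGIN SYSTEM (Mazur–Rubin: `KS(T, F_can)` is free of rank one, generated by a
primitive system, so `κ^{Kato} = p^a · unit · κ^{prim}`), `v'' :=` the index of `loc_p^s z` in the rank-one
lattice `H¹(ℚ_p,T)/H¹_f` (`= ord_p [0]⁺_f =: v'`, Kato's reciprocity law; the Euler factor `1 + 1/p` and the
generator `p⁻¹` of `exp*(H¹(ℚ_p,T))` cancel, `#Ẽ(𝔽_p) = p + 1` is a unit), `ℓ_p(z) :=` the index of `loc_p z`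
in the rank-two lattice `H¹(ℚ_p, T)`, `t := ord_p ∏ c_ℓ`.  KNOWN (Kato + Mazur–Rubin Thm 5.2.12, duality
(7.18) of Kobayashi 2003): `#Ш(E)[p^∞] = p^{v'' − a}`, so the crux is `a ≤ t`.  Every Kato-side line is an
analytic avatar of `a`; the line of record `kim_deficit` reads `a` off the VALUE coordinate (Kurihara numbers
`δ̃_n = exp*`-images of derived classes).  THIS line adds the LOGARITHMIC coordinate and the squaring:
(L3, NEW, provable from print) `Sel_{p^∞}/Sel_str ↪ H¹_f(ℚ_p, E[p^∞]) ≅ ℚ_p/ℤ_p` is CYCLIC of order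
`p^{v''−∂}` (`∂ = ∂^(0)(κ^{Kato}) ≤ ℓ_p(z)`), while Cassels–Tate makes `Ш ≅ M ⊕ M`, so the exponent of `Ш` is at
most `p^{(v''−a)/2}`; hence `a ≤ 2∂ − v'' ≤ 2ℓ_p(z) − v''`, i.e. **`ord_p #Ш ≥ 2·(v'' − ℓ_p(z))`** — every unit of
`p`-adic deficiency of Kato's class at `p` below its own `L`-value is paid TWICE in `Ш`;
(L4, dictionary, Kobayashi 2003 Thm 6.2/6.3, Prop 8.12, 8.23–8.26) `(Col⁺, Col⁻) : H¹_Iw(ℚ_p,T) ↪ Λ²` has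
torsion-free cokernel `Λ/T` (no universal norms at a supersingular prime; `E⁺ ∩ E⁻ = E(ℚ_p)`), so its image is the
full relation module; in the TREE's normalisation (`L⁺(0) = (p−1)[0]⁺` from the odd levels, `L⁻(0) = 2[0]⁺` from
the even levels, Pollack Prop. 6.18 as vendored) the relation is `2·g₊(0) = (p−1)·g₋(0)`, and
`H¹(ℚ_p,T) = (H¹_Iw)_Γ ≅ ℤ_p²` through `(val, λ) = (g₋(0), (2g₊ − (p−1)g₋)'(0))` with `λ(H¹_f) = λ(H¹) = ℤ_p`;
therefore `ℓ_p(z) = min(v', w)`, `w := ord_p coeff₁(2L⁺ − (p−1)L⁻)`, and (L3) reads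
**`ord_p #Ш(E)[p^∞] ≥ 2·(v' − min(v', w))`** (stub 1).  Consequences: `w ≥ v'/2` whenever `p ∣ L(E,1)/Ω` (a
congruence between the two signed DERIVATIVES forced by `a ≥ 0` — checkable); BSD (`a = t`) predicts the
square-root law `w ≥ (v'+t)/2` whenever `w < v'`; and the CERTIFICATE `w ≤ (v'+t)/2` proves the crux for that
pair (it fires exactly when `Ш[p^∞] ≅ (ℤ/p^b)²` with non-degenerate localisation at `p`; for the four uncertified
Rest census cells `138594b1, 246697a1, 321518d1, 331554a1 @ 5`, all `t = 0`, it asks `w = v'/2`, computable from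
the Mazur–Tate elements `θ₂, θ₃` alone — modular symbols of `f` with denominators `p³, p⁴`, no Kolyvagin primes).
The `∀`-statement needs a complement where `Ш` has `p`-rank `≥ 4` or degenerate localisation: there the derived
classes take over (local detection `a = min_{n,k} ℓ_p(κ_n)`, Mazur–Rubin core vertices + self-duality of `E[p]`),
typed here conservatively in the VALUE currency the tree already has (Kim certificate, shared with `kim_deficit`).

Stubs (4 in v1; 5 in v2 — see the v2 section below, S1 is split into S1a/S1b):
* `stub_shaSquare_of_logWronskian` (v1; in v2 the theorem `shaSquare_of_logWronskian_of_split`) — NEW, PROVABLE FROM PRINT (size L; Kato 2004 Thm 12.5, Mazur–Rubin 2004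
  Thm 5.2.10/5.2.12, Cassels–Tate, Kobayashi 2003 Thm 6.2/6.3 + Prop 8.12/8.23–8.26 + (7.18); big image is
  automatic: semistable + good supersingular `p ≥ 5` ⇒ `ρ̄_{E,p}` surjective, Serre 1972 §5.4 Prop. 21 shape):
  junk-free divisibility form of `ord_p #Ш ≥ 2(v' − min(v', w))`.
* `stub_missingLowerBoundAt_of_logSquare_X6` — ENGINE (bookkeeping, closable modulo the named facts
  `exists_isNewformOf`, `pollack_exists_plusMinusPAdicLFunction`, `realPeriodRat_eq_unit_mul_plusPeriod`, GZK):
  `ord_p #Ш_an = v' − t` on X6 ∧ `r_an = 0` ∧ `p ≥ 5` (`p ∤ #E(ℚ)_tors` at a supersingular `p`, `L⁻(0) = 2[0]⁺_f`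
  from the level-`0` congruence, period ratio a unit), so a witnessed `v' ≤ s + t`, `s ≤ ord_p #Ш` gives
  `Typed.MissingLowerBoundAt W p`.
* `stub_logSquareOrKuriharaCertificate_X6Rest` — THE HARD STUB (class-wide, open; a DICHOTOMY strictly weaker than
  `kim_deficit`'s `∂^(∞)(δ̃) ≤ t`): on X6-Rest ∧ ¬CM ∧ `p ≥ 5` ∧ `r_an = 0`, EITHER the level-one log-square
  certificate fires (`v' ≤ 2(v' − w) + t`, witnessed junk-free) OR some Kurihara number of depth `≤ t + 1` is
  non-zero.  Why it might hold: `a = min_n ℓ_p(κ_n)` (local detection) and BSD gives `a = t`; branch A is the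
  `n = 1` log face, branch B the value face at derived levels (Kurihara–Kim conjecture); jointly they say SOME
  derived Kato class is locally primitive enough in ONE of its two `±`-Coleman coordinates.  Honest price: class-wide
  it is the Kato-side face of the rank-0 main conjecture at the trivial character, as for every line on this crux.
* `stub_missingLowerBoundAt_of_kuriharaCertificate_X6` — SHARED ENGINE, verbatim the statement of
  `KimDeficit.stub_missingLowerBoundAt_of_levelCertificate_X6` (one proof closes both; Kim 2026 Thm 1.8 (6)).

Composition: `EisensteinHalfFiveLeRest_of : InputGZK → S1a → S1b → S2 → S3 → S4 → EisensteinHalfFiveLeRest`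
(cases on S3: branch A feeds S1 = S1b ∘ S1a then S2, branch B feeds S4; the crux's `q` is the rational
`#Ш_an` of `MissingLowerBoundAt` by injectivity of `ℚ → ℂ`).

## v2 (x6-p2 LEAD g4, 2026-08-28; reshape proposed by x6-p2-w2 g4, evidence #70; LEAD READ
## `Lines/log-witness-lead-read.md` §1): S1 SPLIT at the Cassels–Tate squaring

The LEAD READ showed that S1 is a theorem of print WITHOUT Mazur–Rubin: (a) Kobayashi level-`0`
Coleman coordinates, (b) Kato's integral class on `H¹(G_S, T) ≅ ℤ_p`, (c) the Poitou–Tate count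
(Kobayashi (7.18))^∨ — together: `Ш(E)` has a CYCLIC QUOTIENT of order `p^{v'−∂}`,
`v' − ∂ ≥ v' − min(v', w)` — and (d) the squaring `(#C)² ∣ #Ш` (Cassels–Tate + Wall/Tignol–Amitsur).
Accordingly S1 is now the composite of two stubs, both stated in EXISTING tree vocabulary:
* `stub_logDeficitCyclicQuotient` (S1a — steps (a)–(c); typer-gated: its closer needs the Literature
  facts M2 «Kobayashi level-0 coordinates», M3 «Poitou–Tate cyclic-quotient count», M4 «`H¹(G_S,T_pE) =
  ℤ_p·c ∋ z_Kato`» of the READ §3, hence lands as `…_of_facts` + planner Input items, like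
  `KimDeficit` stub 2): under S1's binders, `p^m ∣ L₁(0)` and `p^{e+1} ∤ coeff₁ 𝔚` give a surjection
  `Ш(E) ↠ ℤ/p^{m−e}`;
* `stub_shaSquare_of_cyclicQuotient` (S1b — step (d); SERVED BY NAME modulo the Cassels–Tate fact
  bsd.S18 `exists_casselsTate_pairing (K := ℚ)` by
  `Theorems/PrintX6EisensteinHalfFiveLeRestLogWitnessSquare.lean` (p613951 +
  `stub_shaSquare_of_cyclicQuotient_of_casselsTate`); credit would need a route Input item
  `InputCasselsTate` — planner TURNKEY): a finite `Ш(E)` with a surjection onto `ℤ/p^k` has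
  `2k ≤ ord_p #Ш(E)`;
and the former stub statement `stub_shaSquare_of_logWronskian` is now the THEOREM
`shaSquare_of_logWronskian_of_split : InputGZK → S1b → S1a → ⟨S1 text⟩` (finiteness of `Ш` at
`r_an = 0` from the route item `InputGZK`). The composition takes the TAGGED route item `InputGZK` as
its only non-stub hypothesis. Stubs are now 5 (S1a, S1b, S2, S3, S4); S2 is served by name mod the pack
(p611563), S4 ≡ `KimDeficit` stub 2 (p610149 §2b under the TURNKEY header), S3 is the hard stub.
Skeleton of record of the crux stays `Lines/kim_deficit.lean` (W-79); this file is PUBLISHED, not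
registered.
-/

set_option autoImplicit false
set_option linter.dupNamespace false

noncomputable section

open scoped Classical MatrixGroups ModularForm

open CongruenceSubgroup WeierstrassCurve Literature.NumberTheory.EllipticCurves
  Literature.NumberTheory.EllipticCurves.ModularForms
  Literature.NumberTheory.EllipticCurves.Rank1Residual
  Literature.NumberTheory.EllipticCurves.Rank1Residual.Typed
  Summit.BirchSwinnertonDyer.Rank1Residual.Supersingular

namespace Summit.BirchSwinnertonDyer.BirchSwinnertonDyer.Cruxes.EisensteinHalfFiveLeRest.LogWitness

/-! ### The `±`-log-Wronskian -/

/-- The `±`-LOG-WRONSKIAN of a Pollack pair in the tree's normalisation: for `L₁ = L_p⁻` (even-level congruences,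
`L₁(0) = 2[0]⁺_f`, Kobayashi's `ε = 1`) and `L₂ = L_p⁺` (odd levels, `L₂(0) = (p−1)[0]⁺_f`, Kobayashi's
`ε = −1`), `𝔚 := 2·L₂ − (p−1)·L₁ ∈ Λ = ℤ_p⟦T⟧`; its constant term vanishes identically and its LINEAR coefficient is
the logarithmic coordinate `λ(loc_p z_Kato)` of Kato's class in `H¹(ℚ_p, T_pE) ≅ ℤ_p²` (module docstring, (L4)).
[cite: Pollack2003, Prop. 6.18] [cite: Kobayashi2003, Thm. 6.2, Thm. 6.3, Prop. 8.25] -/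
def logWronskian (p : ℕ) [Fact p.Prime] (L₁ L₂ : IwasawaAlgebra p) : IwasawaAlgebra p :=
  PowerSeries.C (2 : ℤ_[p]) * L₂ - PowerSeries.C ((p : ℤ_[p]) - 1) * L₁

/-! ### The four registered stubs -/

/-- STUB 1a (S1a — THE LEVEL-`0` LOG-DEFICIT CYCLIC QUOTIENT; steps (a)–(c) of the LEAD READ §1;
typer-gated): on X6 ∧ ¬CM ∧ `p ≥ 5` ∧ `r_an = 0`, for the newform `f` of `W` and the Pollack pair
`(L₁, L₂) = (L_p⁻, L_p⁺)` (Kobayashi's labels `ε = 1, −1`), if `p^m ∣ L₁(0)` (so `m ≤ v'`) and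
`p^{e+1} ∤ 𝔚'(0)` (so `e ≥ w`), then `Ш(E)` SURJECTS onto `ℤ/p^{m−e}`. Proof route (print):
(a) Kobayashi Thm 6.2 (6.13)/(6.14) + Prop 8.12 ii + Thm 6.3: `(Col⁺, Col⁻) : H¹_Iw(T) ↪ Λ²` has
cokernel `Λ/(X)` and image `{(p−1)g₁(0) = 2g₂(0)}` (forced by the PROVED constant terms
`L₁(0) = 2[0]⁺`, `L₂(0) = (p−1)[0]⁺`), so `loc_p z_Kato ∈ H¹(ℚ_p,T) ≅ ℤ_p²` has coordinates of
valuations `(v', w)`, `ℓ_p(z) = min(v', w)`, and its singular part has valuation exactly `v'`;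
(b) `E[p]` irreducible + `Sel_{p^∞}` finite ⇒ `H¹(G_S,T) = ℤ_p·c`, Kato's integral class `z = p^∂uc`,
`∂ ≤ ℓ_p(z)`; (c) (7.18)^∨: the image of `Sel_{p^∞}(E/ℚ) = Ш(E)[p^∞]` in
`E(ℚ_p) ⊗ ℚ_p/ℤ_p ≅ ℚ_p/ℤ_p` is cyclic of order `p^{v'−∂}`, `v' − ∂ ≥ v' − min(v',w) ≥ m − e`.
Closable only as `…_of_facts` from the Literature facts M2/M3/M4 of the READ (planner Input items
for credit) — exactly as `KimDeficit` stub 2.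
[cite: Kobayashi2003, Thm. 6.2, Thm. 6.3, Prop. 8.12, (7.18)] [cite: Kato2004Asterisque, Thm. 12.5] -/
theorem stub_logDeficitCyclicQuotient :
    ∀ (W : WeierstrassCurve ℚ) [W.IsElliptic] [W.IsGloballyMinimal] (p : ℕ) [Fact p.Prime],
      ¬ W.HasCM → 5 ≤ p → ClassX6 W p → W.analyticRank = 0 →
      ∀ [NeZero (W.conductorNorm ℤ)] (f : CuspForm (Gamma0 (W.conductorNorm ℤ)) 2), IsNewformOf W f →
        ∀ (L₁ L₂ : IwasawaAlgebra p), Kobayashi2003.IsSignedPAdicLFunction f p 1 L₁ →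
          Kobayashi2003.IsSignedPAdicLFunction f p (-1) L₂ →
          ∀ (m e : ℕ), (p : ℤ_[p]) ^ m ∣ PowerSeries.constantCoeff L₁ →
            ¬ (p : ℤ_[p]) ^ (e + 1) ∣ PowerSeries.coeff 1 (logWronskian p L₁ L₂) →
            ∃ φ : W.sha →+ ZMod (p ^ (m - e)), Function.Surjective φ := by
  sorry

/-- STUB 1b (S1b — THE CASSELS–TATE SQUARING; step (d); SERVED BY NAME modulo bsd.S18 by
`Theorems/PrintX6EisensteinHalfFiveLeRestLogWitnessSquare.lean`): a FINITE `Ш(E)` with a surjection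
onto `ℤ/p^k` has `2k ≤ ord_p #Ш(E)` — by the Cassels–Tate pairing `Ш(E) ≅ N ⊕ N` (Wall 1963 /
Tignol–Amitsur 1986 for a nondegenerate alternating pairing), so a cyclic quotient `C` has
`#C = exp C ∣ exp N ∣ #N`, `(#C)² ∣ #Ш(E)`. As typed it carries no fact binder (the Cassels–Tate
pairing is bsd.S18 `exists_casselsTate_pairing`, refereed print, UNPROVED in the tree), so its
by-name closer is `stub_shaSquare_of_cyclicQuotient_of_casselsTate`; credit needs a route Input item
`InputCasselsTate` (planner TURNKEY). [cite: SilvermanAEC2009, Thm. X.4.14] [cite: Cassels1962ArithmeticIV]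
[cite: Wall1963QuadraticFormsFiniteGroups, Lemma 7] -/
theorem stub_shaSquare_of_cyclicQuotient :
    ∀ (W : WeierstrassCurve ℚ) [W.IsElliptic] (p k : ℕ) [Fact p.Prime], Finite W.sha →
      (∃ φ : W.sha →+ ZMod (p ^ k), Function.Surjective φ) → 2 * k ≤ padicValNat p W.shaOrder := by
  sorry

/-- **S1 = S1b ∘ S1a** (formerly the stub `stub_shaSquare_of_logWronskian`, now a theorem of the two
stubs above and the route item `InputGZK`, which supplies the finiteness of `Ш(E)` at `r_an = 0`):
the Cassels–Tate square of the log-deficiency of Kato's class, `ord_p #Ш ≥ 2(v' − min(v', w))` in its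
junk-free form `p^m ∣ L₁(0) ∧ p^{e+1} ∤ coeff₁ 𝔚 ⇒ 2(m − e) ≤ ord_p #Ш`. [folklore] -/
theorem shaSquare_of_logWronskian_of_split
    (hGZK : Summit.BirchSwinnertonDyer.BirchSwinnertonDyer.Theses.PrintX6.InputGZK)
    (h1b : ∀ (W : WeierstrassCurve ℚ) [W.IsElliptic] (p k : ℕ) [Fact p.Prime], Finite W.sha →
      (∃ φ : W.sha →+ ZMod (p ^ k), Function.Surjective φ) → 2 * k ≤ padicValNat p W.shaOrder)
    (h1a : ∀ (W : WeierstrassCurve ℚ) [W.IsElliptic] [W.IsGloballyMinimal] (p : ℕ) [Fact p.Prime],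
      ¬ W.HasCM → 5 ≤ p → ClassX6 W p → W.analyticRank = 0 →
      ∀ [NeZero (W.conductorNorm ℤ)] (f : CuspForm (Gamma0 (W.conductorNorm ℤ)) 2), IsNewformOf W f →
        ∀ (L₁ L₂ : IwasawaAlgebra p), Kobayashi2003.IsSignedPAdicLFunction f p 1 L₁ →
          Kobayashi2003.IsSignedPAdicLFunction f p (-1) L₂ →
          ∀ (m e : ℕ), (p : ℤ_[p]) ^ m ∣ PowerSeries.constantCoeff L₁ →
            ¬ (p : ℤ_[p]) ^ (e + 1) ∣ PowerSeries.coeff 1 (logWronskian p L₁ L₂) →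
            ∃ φ : W.sha →+ ZMod (p ^ (m - e)), Function.Surjective φ) :
    ∀ (W : WeierstrassCurve ℚ) [W.IsElliptic] [W.IsGloballyMinimal] (p : ℕ) [Fact p.Prime],
      ¬ W.HasCM → 5 ≤ p → ClassX6 W p → W.analyticRank = 0 →
      ∀ [NeZero (W.conductorNorm ℤ)] (f : CuspForm (Gamma0 (W.conductorNorm ℤ)) 2), IsNewformOf W f →
        ∀ (L₁ L₂ : IwasawaAlgebra p), Kobayashi2003.IsSignedPAdicLFunction f p 1 L₁ →
          Kobayashi2003.IsSignedPAdicLFunction f p (-1) L₂ →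
          ∀ (m e : ℕ), (p : ℤ_[p]) ^ m ∣ PowerSeries.constantCoeff L₁ →
            ¬ (p : ℤ_[p]) ^ (e + 1) ∣ PowerSeries.coeff 1 (logWronskian p L₁ L₂) →
            2 * (m - e) ≤ padicValNat p W.shaOrder := by
  intro W _ _ p _ hCM hp5 hX hr0 _ f hf L₁ L₂ hL₁ hL₂ m e hm he
  have hfin : Finite W.sha := (hGZK W (by rw [hr0]; exact zero_le_one)).2
  exact h1b W p (m - e) hfin (h1a W p hCM hp5 hX hr0 f hf L₁ L₂ hL₁ hL₂ m e hm he)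

/-- STUB 2 (ENGINE — bookkeeping, closable modulo the named facts `exists_isNewformOf`,
`pollack_exists_plusMinusPAdicLFunction`, `realPeriodRat_eq_unit_mul_plusPeriod`, GZK): on X6 ∧ `p ≥ 5` ∧ `r_an = 0`
one has `#Ш_an = (L(E,1)/Ω_E)·#T²/∏ c_ℓ ∈ ℚ`, `p ∤ #T` (no `p`-torsion at a supersingular `p`), `Ω_E = u·Ω⁺_f`,
`|u|_p = 1`, and `L₁(0) = 2[0]⁺_f` (level-`0` congruence `θ₀ ≡ −L₁ (mod T)`, `θ₀ = −2[0]⁺` for `a_p = 0`), so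
`ord_p #Ш_an = v' − t` with `v' = max{m : p^m ∣ L₁(0)}`, `t = ord_p ∏ c_ℓ`; hence a witnessed pair of inequalities
`v' ≤ s + t`, `s ≤ ord_p #Ш` (for every newform and Pollack pair — they exist by the facts) yields the lower half
`Typed.MissingLowerBoundAt W p`. [cite: Kobayashi2003, (3.4) (p. 7)] [cite: Pollack2003, Prop. 6.18]
[cite: Kim2022StructureSelmer, §1.5.1–1.5.3 (PDF pp. 7–8)] -/
theorem stub_missingLowerBoundAt_of_logSquare_X6 :
    ∀ (W : WeierstrassCurve ℚ) [W.IsElliptic] [W.IsGloballyMinimal] (p : ℕ) [Fact p.Prime],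
      5 ≤ p → ClassX6 W p → W.analyticRank = 0 →
      (∀ [NeZero (W.conductorNorm ℤ)] (f : CuspForm (Gamma0 (W.conductorNorm ℤ)) 2), IsNewformOf W f →
        ∀ (L₁ L₂ : IwasawaAlgebra p), Kobayashi2003.IsSignedPAdicLFunction f p 1 L₁ →
          Kobayashi2003.IsSignedPAdicLFunction f p (-1) L₂ →
          ∃ s : ℕ, (∀ m : ℕ, (p : ℤ_[p]) ^ m ∣ PowerSeries.constantCoeff L₁ →
              m ≤ s + padicValNat p W.tamagawaProduct) ∧
            s ≤ padicValNat p W.shaOrder) →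
      MissingLowerBoundAt W p := by
  sorry

/-- STUB 3 — THE HARD STUB (class-wide, OPEN; a dichotomy strictly weaker than `kim_deficit`'s hard stub): on X6
∧ ¬CM ∧ `p ≥ 5` ∧ `r_an = 0` OFF the erratum sub-locus, for the newform `f` of `W`: EITHER (A, the `n = 1`
LOG-SQUARE CERTIFICATE) for the Pollack pair there are `m ≤ v'`, `e ≥ w` with `v' ≤ 2(m − e) + t` — i.e.
`w ≤ (v' + t)/2`, the log-coordinate of Kato's class is at most half-way between the Tamagawa exponent and the
`L`-value — OR (B, VALUE FACE AT DERIVED LEVELS) some Kurihara number of `f` of depth `k ≤ t + 1` at a cyclic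
Kolyvagin level is non-zero (the certificate shape of `kim_deficit`).  Why it might hold: local detection
`a = min_{n,k} ℓ_p(κ_n)` (Mazur–Rubin core vertices: `H¹_{F(n),str}(ℚ, E[p]) = 0`, so `loc_p` is injective on the
stalk) and `a = t` under BSD; (A) is its `n = 1` logarithmic face, (B) its value face; per pair both are DECIDABLE
from modular symbols ((A): `θ₂, θ₃` only).  Why it might fail AS TYPED: (A) fails whenever `Ш[p^∞]` has `p`-rank
`≥ 4` or localises degenerately at `p`, and then (B) is the Kurihara–Kim conjecture; class-wide the disjunction is
the Kato-side face of the rank-`0` main conjecture at the trivial character.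
[cite: MazurRubin2004KolyvaginSystems, Thm. 4.1.7, Thm. 5.2.12] [cite: Kim2022StructureSelmer, Conj. 1.10 (PDF p. 8)]
[cite: Kobayashi2003, Thm. 6.3] -/
theorem stub_logSquareOrKuriharaCertificate_X6Rest :
    ∀ (W : WeierstrassCurve ℚ) [W.IsElliptic] [W.IsGloballyMinimal] (p : ℕ) [Fact p.Prime],
      ¬ W.HasCM → 5 ≤ p → ClassX6 W p → W.analyticRank = 0 → ¬ HasErratumPrime W p →
      (∀ [NeZero (W.conductorNorm ℤ)] (f : CuspForm (Gamma0 (W.conductorNorm ℤ)) 2), IsNewformOf W f →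
        ∀ (L₁ L₂ : IwasawaAlgebra p), Kobayashi2003.IsSignedPAdicLFunction f p 1 L₁ →
          Kobayashi2003.IsSignedPAdicLFunction f p (-1) L₂ →
          ∃ m e : ℕ, (p : ℤ_[p]) ^ m ∣ PowerSeries.constantCoeff L₁ ∧
            ¬ (p : ℤ_[p]) ^ (e + 1) ∣ PowerSeries.coeff 1 (logWronskian p L₁ L₂) ∧
            ∀ m' : ℕ, (p : ℤ_[p]) ^ m' ∣ PowerSeries.constantCoeff L₁ →
              m' ≤ 2 * (m - e) + padicValNat p W.tamagawaProduct) ∨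
      (∀ [NeZero (W.conductorNorm ℤ)] (f : CuspForm (Gamma0 (W.conductorNorm ℤ)) 2), IsNewformOf W f →
        ∃ (k n : ℕ) (_ : NeZero n), 1 ≤ k ∧ k ≤ padicValNat p W.tamagawaProduct + 1 ∧
          Kato.IsKolyvaginProduct W p k n ∧
          (∀ (ℓ : ℕ) [Fact ℓ.Prime], ℓ ∣ n →
            Nat.card {P : ((WeierstrassCurve.integralModelInt W).map
                (Int.castRingHom (ZMod ℓ))).toAffine.Point // p • P = 0} ≤ p) ∧
          ∃ ψ : (ℓ : ℕ) → (ZMod ℓ)ˣ →* Multiplicative (ZMod (p ^ k)),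
            (∀ ℓ ∈ n.primeFactors, Function.Surjective (ψ ℓ)) ∧
              kuriharaNumber f (p ^ k) n ψ ≠ 0) := by
  sorry

/-- STUB 4 (SHARED ENGINE — verbatim the statement of `KimDeficit.stub_missingLowerBoundAt_of_levelCertificate_X6`
of the line of record `kim_deficit`; one proof closes both; closable modulo Kim 2026 Thm. 1.8 (6) =
`Kim2026.rankZero_le_padicValNat_sha_of_kuriharaNumber_ne_zero` and the tree theorem
`X4.missingLowerBoundAt_rankZero_of_kimLower`): on X6 ∧ `p ≥ 5` ∧ `r_an = 0`, a Kurihara certificate of depth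
`k ≤ t + 1` gives `Typed.MissingLowerBoundAt W p`.
[cite: Kim2022StructureSelmer, Thm. 1.9 (6) (PDF p. 8) and §1.5.1–1.5.3 (PDF pp. 7–8)] -/
theorem stub_missingLowerBoundAt_of_kuriharaCertificate_X6 :
    ∀ (W : WeierstrassCurve ℚ) [W.IsElliptic] [W.IsGloballyMinimal] (p : ℕ) [Fact p.Prime],
      5 ≤ p → ClassX6 W p → W.analyticRank = 0 →
      (∀ [NeZero (W.conductorNorm ℤ)] (f : CuspForm (Gamma0 (W.conductorNorm ℤ)) 2), IsNewformOf W f →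
        ∃ (k n : ℕ) (_ : NeZero n), 1 ≤ k ∧ k ≤ padicValNat p W.tamagawaProduct + 1 ∧
          Kato.IsKolyvaginProduct W p k n ∧
          (∀ (ℓ : ℕ) [Fact ℓ.Prime], ℓ ∣ n →
            Nat.card {P : ((WeierstrassCurve.integralModelInt W).map
                (Int.castRingHom (ZMod ℓ))).toAffine.Point // p • P = 0} ≤ p) ∧
          ∃ ψ : (ℓ : ℕ) → (ZMod ℓ)ˣ →* Multiplicative (ZMod (p ^ k)),
            (∀ ℓ ∈ n.primeFactors, Function.Surjective (ψ ℓ)) ∧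
              kuriharaNumber f (p ^ k) n ψ ≠ 0) →
      MissingLowerBoundAt W p := by
  sorry

/-! ### The composition (no `sorry`) -/

/-- **The five stub statements and the route item `InputGZK` give the crux `PrintX6.EisensteinHalfFiveLeRest` by
name.**  Per pair `(W, p)` on
X6-Rest ∧ ¬CM ∧ `r_an = 0` ∧ `p ≥ 5`: stub 3 splits; in branch A stub 1 squares the log-deficiency into
`2(m − e) ≤ ord_p #Ш` and stub 2 turns `v' ≤ 2(m − e) + t` into `Typed.MissingLowerBoundAt W p`; in branch B
stub 4 does the same from the Kurihara certificate; the crux's `q` is the rational `#Ш_an` by injectivity of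
`ℚ → ℂ`. [folklore] -/
theorem EisensteinHalfFiveLeRest_of
    (hGZK : Summit.BirchSwinnertonDyer.BirchSwinnertonDyer.Theses.PrintX6.InputGZK) :
    (∀ (W : WeierstrassCurve ℚ) [W.IsElliptic] [W.IsGloballyMinimal] (p : ℕ) [Fact p.Prime],
      ¬ W.HasCM → 5 ≤ p → ClassX6 W p → W.analyticRank = 0 →
      ∀ [NeZero (W.conductorNorm ℤ)] (f : CuspForm (Gamma0 (W.conductorNorm ℤ)) 2), IsNewformOf W f →
        ∀ (L₁ L₂ : IwasawaAlgebra p), Kobayashi2003.IsSignedPAdicLFunction f p 1 L₁ →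
          Kobayashi2003.IsSignedPAdicLFunction f p (-1) L₂ →
          ∀ (m e : ℕ), (p : ℤ_[p]) ^ m ∣ PowerSeries.constantCoeff L₁ →
            ¬ (p : ℤ_[p]) ^ (e + 1) ∣ PowerSeries.coeff 1 (logWronskian p L₁ L₂) →
            ∃ φ : W.sha →+ ZMod (p ^ (m - e)), Function.Surjective φ) →
    (∀ (W : WeierstrassCurve ℚ) [W.IsElliptic] (p k : ℕ) [Fact p.Prime], Finite W.sha →
      (∃ φ : W.sha →+ ZMod (p ^ k), Function.Surjective φ) → 2 * k ≤ padicValNat p W.shaOrder) →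
    (∀ (W : WeierstrassCurve ℚ) [W.IsElliptic] [W.IsGloballyMinimal] (p : ℕ) [Fact p.Prime],
      5 ≤ p → ClassX6 W p → W.analyticRank = 0 →
      (∀ [NeZero (W.conductorNorm ℤ)] (f : CuspForm (Gamma0 (W.conductorNorm ℤ)) 2), IsNewformOf W f →
        ∀ (L₁ L₂ : IwasawaAlgebra p), Kobayashi2003.IsSignedPAdicLFunction f p 1 L₁ →
          Kobayashi2003.IsSignedPAdicLFunction f p (-1) L₂ →
          ∃ s : ℕ, (∀ m : ℕ, (p : ℤ_[p]) ^ m ∣ PowerSeries.constantCoeff L₁ →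
              m ≤ s + padicValNat p W.tamagawaProduct) ∧
            s ≤ padicValNat p W.shaOrder) →
      MissingLowerBoundAt W p) →
    (∀ (W : WeierstrassCurve ℚ) [W.IsElliptic] [W.IsGloballyMinimal] (p : ℕ) [Fact p.Prime],
      ¬ W.HasCM → 5 ≤ p → ClassX6 W p → W.analyticRank = 0 → ¬ HasErratumPrime W p →
      (∀ [NeZero (W.conductorNorm ℤ)] (f : CuspForm (Gamma0 (W.conductorNorm ℤ)) 2), IsNewformOf W f →
        ∀ (L₁ L₂ : IwasawaAlgebra p), Kobayashi2003.IsSignedPAdicLFunction f p 1 L₁ →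
          Kobayashi2003.IsSignedPAdicLFunction f p (-1) L₂ →
          ∃ m e : ℕ, (p : ℤ_[p]) ^ m ∣ PowerSeries.constantCoeff L₁ ∧
            ¬ (p : ℤ_[p]) ^ (e + 1) ∣ PowerSeries.coeff 1 (logWronskian p L₁ L₂) ∧
            ∀ m' : ℕ, (p : ℤ_[p]) ^ m' ∣ PowerSeries.constantCoeff L₁ →
              m' ≤ 2 * (m - e) + padicValNat p W.tamagawaProduct) ∨
      (∀ [NeZero (W.conductorNorm ℤ)] (f : CuspForm (Gamma0 (W.conductorNorm ℤ)) 2), IsNewformOf W f →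
        ∃ (k n : ℕ) (_ : NeZero n), 1 ≤ k ∧ k ≤ padicValNat p W.tamagawaProduct + 1 ∧
          Kato.IsKolyvaginProduct W p k n ∧
          (∀ (ℓ : ℕ) [Fact ℓ.Prime], ℓ ∣ n →
            Nat.card {P : ((WeierstrassCurve.integralModelInt W).map
                (Int.castRingHom (ZMod ℓ))).toAffine.Point // p • P = 0} ≤ p) ∧
          ∃ ψ : (ℓ : ℕ) → (ZMod ℓ)ˣ →* Multiplicative (ZMod (p ^ k)),
            (∀ ℓ ∈ n.primeFactors, Function.Surjective (ψ ℓ)) ∧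
              kuriharaNumber f (p ^ k) n ψ ≠ 0)) →
    (∀ (W : WeierstrassCurve ℚ) [W.IsElliptic] [W.IsGloballyMinimal] (p : ℕ) [Fact p.Prime],
      5 ≤ p → ClassX6 W p → W.analyticRank = 0 →
      (∀ [NeZero (W.conductorNorm ℤ)] (f : CuspForm (Gamma0 (W.conductorNorm ℤ)) 2), IsNewformOf W f →
        ∃ (k n : ℕ) (_ : NeZero n), 1 ≤ k ∧ k ≤ padicValNat p W.tamagawaProduct + 1 ∧
          Kato.IsKolyvaginProduct W p k n ∧
          (∀ (ℓ : ℕ) [Fact ℓ.Prime], ℓ ∣ n →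
            Nat.card {P : ((WeierstrassCurve.integralModelInt W).map
                (Int.castRingHom (ZMod ℓ))).toAffine.Point // p • P = 0} ≤ p) ∧
          ∃ ψ : (ℓ : ℕ) → (ZMod ℓ)ˣ →* Multiplicative (ZMod (p ^ k)),
            (∀ ℓ ∈ n.primeFactors, Function.Surjective (ψ ℓ)) ∧
              kuriharaNumber f (p ^ k) n ψ ≠ 0) →
      MissingLowerBoundAt W p) →
    Summit.BirchSwinnertonDyer.BirchSwinnertonDyer.Theses.PrintX6.EisensteinHalfFiveLeRest := by
  intro h₁a h₁b h₂ h₃ h₄ W _ _ p _ hCM hp5 hX hr0 hRest q hq _hvq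
  have h₁ := shaSquare_of_logWronskian_of_split hGZK h₁b h₁a
  have hlow : MissingLowerBoundAt W p := by
    rcases h₃ W p hCM hp5 hX hr0 hRest with hA | hB
    · refine h₂ W p hp5 hX hr0 ?_
      intro _ f hf L₁ L₂ hL₁ hL₂
      obtain ⟨m, e, hm, he, hmax⟩ := hA f hf L₁ L₂ hL₁ hL₂
      exact ⟨2 * (m - e), hmax, h₁ W p hCM hp5 hX hr0 f hf L₁ L₂ hL₁ hL₂ m e hm he⟩
    · refine h₄ W p hp5 hX hr0 ?_
      intro _ f hf
      exact hB f hf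
  obtain ⟨q', hq', hle⟩ := hlow
  have hqq : q = q' := by exact_mod_cast hq.symm.trans hq'
  subst hqq
  exact hle

/-- The stubs, applied: their signatures are literally the five stub hypotheses of `EisensteinHalfFiveLeRest_of`,
whose only other hypothesis is the TAGGED route item `InputGZK` (kernel check of the skeleton's shape; depends on
the five `sorry`s and on nothing else). [folklore] -/
theorem EisensteinHalfFiveLeRest_of_stubs
    (hGZK : Summit.BirchSwinnertonDyer.BirchSwinnertonDyer.Theses.PrintX6.InputGZK) :
    Summit.BirchSwinnertonDyer.BirchSwinnertonDyer.Theses.PrintX6.EisensteinHalfFiveLeRest :=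
  EisensteinHalfFiveLeRest_of hGZK stub_logDeficitCyclicQuotient stub_shaSquare_of_cyclicQuotient
    stub_missingLowerBoundAt_of_logSquare_X6 stub_logSquareOrKuriharaCertificate_X6Rest
    stub_missingLowerBoundAt_of_kuriharaCertificate_X6

end Summit.BirchSwinnertonDyer.BirchSwinnertonDyer.Cruxes.EisensteinHalfFiveLeRest.LogWitness

end
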